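import Literature.NumberTheory.LFunctions.AlternativeHypothesisCorollary4Proofs
import Literature.NumberTheory.LFunctions.AlternativeHypothesisCorollary4Constants
import Literature.NumberTheory.LFunctions.AlternativeHypothesisTheorem3Holds
import HarnessLib

/-!
# BGSTB 2025, Corollary 4 from the STATEMENT of Theorem 3 (`bgstb2025_corollary4_of_theorem3`)

Topic `Literature/NumberTheory/LFunctions` (namespace `Literature.NumberTheory.LFunctions`, helpers
in `AH.Cor4OfThm3`). PROOF LAYER, cell `rh-crit/ah` (C5, seat t6 g4, row «Cor4-of-Thm3», scope memo
`ah/MEMO-t6-Cor4-scope.md`); theorems only, no definitions, no named facts. LABEL: **NOT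
RH-BEARING** — Corollary 4 (ii)–(iv) are CONDITIONALS on RH and AH-Pairs (both stay hypotheses
inside the typed statement), derived here from the typed statement `bgstb2025_theorem3` taken as a
HYPOTHESIS; nothing here bears on the truth of RH or of AH.

S. A. C. Baluyot, D. A. Goldston, A. I. Suriajaya, C. L. Turnage-Butterbaugh, *The Alternative
Hypothesis for zeros of the Riemann zeta-function*, arXiv:2508.10857 (2025; UNREFEREED), Corollary 4
(b) (TeX l.593–600) and its proof (§7, TeX l.1110–1156): "Now assume RH and AH-Pairs. We obtain as
above `∫_1^∞ F(α)/α² dα = ∫_1^U F(α)/α² dα + O(U^{-1}) ∼ ∫_1^U 𝓕(α)/α² dα + O(U^{-1})`. Applying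
Theorem 3 to the interval `[1,U]`, with `U ∉ ℤ`, we have `∫_1^U 𝓕(α)/α² dα = … =
1 + (3/2(P_0−1) + 1/4) π²/6 + ∑_{n≥1} log(1 − 1/(4n²)) + O(U^{-1})` … `= log(2/π)` … on letting
`U = U(T) → ∞` as `T → ∞`. If the limiting density `p_0 = lim P_0(T)` exists, then …
`𝒞 = 1 + (3/2(p_0−1)+1/4) π²/6 + log(2/π)`."

## What is proved (our rendering of the printed proof on the typed objects)

* (private helpers) the test function `g(α) = 1/max(α,1)²` is globally
  `2`-Lipschitz, hence satisfies every regularity hypothesis of the typed Theorem 3 (which asks for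
  Lipschitz continuity at EVERY integer `≠ ±1`; `1/α²` itself would fail at `0`), and agrees with
  `1/α²` on `[1, U]`.
* `AH.Cor4OfThm3.calFIntegral_invMaxSq` — the limiting functional of Theorem 3 on `[1, N + ½]`:
  `∫_1^{N+½} 𝓕 g = ∫_1^{N+½} s(α)/α² dα + 2(P_0 − 1) + ∑_{2≤m≤N, m even} m^{-2}
  + 2(P_0 − 1) ∑_{3≤m≤N, m odd} m^{-2}` (`U = N + ½ ∉ ℤ`, as the typed endpoint condition demands).
* the two atom sums above tend to `π²/24` and `π²/8 − 1` — the cell's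
  `AH.Cor4.tendsto_sum_Ioo_even` / `AH.Cor4.tendsto_sum_Ioo_odd`
  (`AlternativeHypothesisCorollary4Constants.lean`, cited by name, not restated).
* `corollary4_ii_of_theorem3_of_triangleLimit` — conjunct (ii) of `bgstb2025_corollary4` with the
  constant written `S + 2(p_0 − 1)·π²/8 + π²/24`, from `bgstb2025_theorem3` (hypothesis) and the
  `T`-free limit `S = lim_N ∫_1^{N+½} s(α)/α² dα` (hypothesis): an `η/8` argument with `U = N + ½`
  chosen BEFORE `T` (no exchange of limits), the tail `∫_U^∞ F/α² ≤ 2C′/U` uniformly in `T` by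
  `F ≥ 0` and Goldston's window bound `exists_integral_formFactor_window_le` (exactly as in the
  tree's proof of Corollary 4 (i)), and the boundedness of `P_0(T)` along `T → ∞` taken from its
  convergence to `p_0` (no appeal to a uniform bound).
* `bgstb2025_corollary4_ii_of_theorem3` — conjunct (ii) verbatim, with `S = 1 + log(2/π)` supplied by
  the cell's triangle-wave computation `AH.Cor4.tendsto_integral_triangleWave_div_sq`
  (`AlternativeHypothesisCorollary4Constants.lean`: the source's
  `∑ (1/(2n−1) − 1/(2n+1)) + ∑ log(1 − 1/(4n²)) = 1 + log(2/π)`, via Wallis).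
* **`bgstb2025_corollary4_of_theorem3 : bgstb2025_theorem3 → bgstb2025_corollary4`** — all four
  conjuncts: (i) is the tree's `bgstb2025_corollary4_i`, (iii)/(iv) are (ii) specialised
  (`bgstb2025_corollary4_special_of_general`). Hence `bgstb2025_corollary4_holds` is a one-liner the
  moment `bgstb2025_theorem3_holds` exists (E-ah-5, the misprinted Fubini display in the proof of
  Lemma 6 (iii), concerns the PROOF of Theorem 3, not this deduction, which uses the Theorem-3
  STATEMENT only).
* **`bgstb2025_corollary4_holds : bgstb2025_corollary4`** — the named fact DISCHARGED, from the
  cell's `bgstb2025_theorem3_holds` (`AlternativeHypothesisTheorem3Holds.lean`).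

## References

* [BaluyotGoldstonSuriajayaTurnageButterbaugh2025] arXiv:2508.10857, Corollary 4 (p. 8), §7 (p. 16).
  [cite: BaluyotGoldstonSuriajayaTurnageButterbaugh2025, Corollary 4 and §7]
* D. A. Goldston, *On the function S(T) in the theory of the Riemann zeta-function*, J. Number
  Theory 27 (1987), Lemma A (the window bound), via the tree's `exists_integral_formFactor_window_le`.
-/

noncomputable section

open Filter Set MeasureTheory Asymptotics
open scoped Real Topology

namespace Literature.NumberTheory.LFunctions

namespace AH.Cor4OfThm3

/-! ## §1. The test function `g(α) = 1/max(α,1)²` -/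

/-- `α ↦ 1/max(α,1)²` is globally `2`-Lipschitz: for `u, v ≥ 1`,
`|u⁻² − v⁻²| = |u − v|(u + v)/(u²v²) ≤ 2|u − v|` and `|max x 1 − max y 1| ≤ |x − y|`. [folklore] -/
private theorem abs_invMaxSq_sub_le (x y : ℝ) :
    |1 / max x 1 ^ 2 - 1 / max y 1 ^ 2| ≤ 2 * |x - y| := by
  have hu : 1 ≤ max x 1 := le_max_right _ _
  have hv : 1 ≤ max y 1 := le_max_right _ _
  have huv : |max x 1 - max y 1| ≤ |x - y| := abs_max_sub_max_le_abs x y 1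
  generalize max x 1 = u at hu huv
  generalize max y 1 = v at hv huv
  have hu0 : 0 < u := by linarith
  have hv0 : 0 < v := by linarith
  have e : 1 / u ^ 2 - 1 / v ^ 2 = (v - u) * ((v + u) / (u ^ 2 * v ^ 2)) := by
    field_simp
    ring
  rw [e, abs_mul]
  have h1 : |(v + u) / (u ^ 2 * v ^ 2)| ≤ 2 := by
    rw [abs_of_nonneg (by positivity), div_le_iff₀ (by positivity)]
    have hu2 : u ≤ u ^ 2 := by nlinarith
    have hv2 : v ≤ v ^ 2 := by nlinarith
    have hu1 : 1 ≤ u ^ 2 := by nlinarith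
    have hv1 : 1 ≤ v ^ 2 := by nlinarith
    have h2 : u * 1 ≤ u ^ 2 * v ^ 2 := mul_le_mul hu2 hv1 zero_le_one (by positivity)
    have h3 : 1 * v ≤ u ^ 2 * v ^ 2 := mul_le_mul hu1 hv2 (by positivity) (by positivity)
    linarith
  calc |v - u| * |(v + u) / (u ^ 2 * v ^ 2)| ≤ |x - y| * 2 := by
        refine mul_le_mul ?_ h1 (abs_nonneg _) (abs_nonneg _)
        rw [abs_sub_comm]; exact huv
    _ = 2 * |x - y| := mul_comm _ _

/-- On `[1, ∞)` the test function is `1/α²`. [folklore] -/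
private theorem invMaxSq_eq {α : ℝ} (hα : 1 ≤ α) : 1 / max α 1 ^ 2 = 1 / α ^ 2 := by
  rw [max_eq_left hα]

/-- `0 ≤ 1/max(α,1)² ≤ 1`. [folklore] -/
private theorem invMaxSq_le_one (α : ℝ) : |1 / max α 1 ^ 2| ≤ 1 := by
  have h1 : 1 ≤ max α 1 := le_max_right _ _
  rw [abs_of_nonneg (by positivity), div_le_one (by positivity)]
  nlinarith

/-- Continuity of the test function. [folklore] -/
private theorem continuous_invMaxSq : Continuous fun α : ℝ ↦ 1 / max α 1 ^ 2 := by
  refine continuous_const.div (by fun_prop) fun α ↦ ?_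
  have h1 : 1 ≤ max α 1 := le_max_right _ _
  positivity

/-! ## §2. The atom sums of `𝓕` on `[1, N + ½]` (the even/odd `ζ(2)` partial sums are the cell's
`AH.Cor4.tendsto_sum_Ioo_even` / `AH.Cor4.tendsto_sum_Ioo_odd`, `AlternativeHypothesisCorollary4Constants.lean`) -/

/-- `⌈N + ½⌉ = N + 1`. [folklore] -/
private theorem ceil_natCast_add_half (N : ℕ) : ⌈(N : ℝ) + 1 / 2⌉ = (N : ℤ) + 1 := by
  rw [Int.ceil_eq_iff]
  push_cast
  constructor <;> linarith

/-- **The limiting functional of Theorem 3 on `[1, N + ½]` against `g = 1/max(α,1)²`**: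
`∫_1^{N+½} 𝓕 g = ∫_1^{N+½} s(α)/α² dα + 2(P_0 − 1) + ∑_{1<m<N+1, m even} m⁻² + 2(P_0 − 1) ∑_{1<m<N+1,
m odd, |m| ≥ 3} m⁻²` (the masses of `AH.calFIntegral`: `δ_0^=` and `δ_{−1}^−` lie outside `[1, N+½]`,
`δ_1^+` contributes `2(P_0 − 1) g(1) = 2(P_0 − 1)`). This is the display (int-mathcal-F) of the
printed proof, first line, before the series are summed.
[cite: BaluyotGoldstonSuriajayaTurnageButterbaugh2025, §7 (proof of Corollary 4, display int-mathcal-F)] -/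
theorem calFIntegral_invMaxSq (P : ℝ) {N : ℕ} (hN : 1 ≤ N) :
    AH.calFIntegral P 1 ((N : ℝ) + 1 / 2) (fun α ↦ 1 / max α 1 ^ 2) =
      (∫ α in (1 : ℝ)..((N : ℝ) + 1 / 2), triangleWave α / α ^ 2) + 2 * (P - 1) +
        (∑ m ∈ (Finset.Ioo (1 : ℤ) (N + 1)).filter (fun m ↦ Even m ∧ m ≠ 0), 1 / (m : ℝ) ^ 2) +
        2 * (P - 1) * ∑ m ∈ (Finset.Ioo (1 : ℤ) (N + 1)).filter (fun m ↦ Odd m ∧ 3 ≤ |m|),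
          1 / (m : ℝ) ^ 2 := by
  have hN1 : (1 : ℝ) ≤ N := by exact_mod_cast hN
  unfold AH.calFIntegral
  have i1 : ¬ ((1 : ℝ) < 0 ∧ (0 : ℝ) ≤ (N : ℝ) + 1 / 2) := fun h ↦ by linarith [h.1]
  have i2 : ¬ ((1 : ℝ) ≤ 0 ∧ (0 : ℝ) < (N : ℝ) + 1 / 2) := fun h ↦ by linarith [h.1]
  have i3 : ((1 : ℝ) ≤ 1 ∧ (1 : ℝ) < (N : ℝ) + 1 / 2) := ⟨le_rfl, by linarith⟩
  have i4 : ¬ ((1 : ℝ) < -1 ∧ (-1 : ℝ) ≤ (N : ℝ) + 1 / 2) := fun h ↦ by linarith [h.1]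
  rw [if_neg i1, if_neg i2, if_pos i3, if_neg i4, Int.floor_one, ceil_natCast_add_half]
  have hg1 : (1 : ℝ) / max (1 : ℝ) 1 ^ 2 = 1 := by simp
  have hint : ∫ α in (1 : ℝ)..((N : ℝ) + 1 / 2), triangleWave α * (1 / max α 1 ^ 2) =
      ∫ α in (1 : ℝ)..((N : ℝ) + 1 / 2), triangleWave α / α ^ 2 := by
    refine intervalIntegral.integral_congr fun α hα ↦ ?_
    rw [uIcc_of_le (by linarith)] at hα
    rw [invMaxSq_eq hα.1]
    ring
  have hmem : ∀ m ∈ Finset.Ioo (1 : ℤ) (N + 1), (1 : ℝ) ≤ (m : ℝ) := fun m hm ↦ by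
    have := (Finset.mem_Ioo.1 hm).1
    exact_mod_cast this.le
  have hse : ∑ m ∈ (Finset.Ioo (1 : ℤ) (N + 1)).filter (fun m ↦ Even m ∧ m ≠ 0),
      1 / max (m : ℝ) 1 ^ 2 =
      ∑ m ∈ (Finset.Ioo (1 : ℤ) (N + 1)).filter (fun m ↦ Even m ∧ m ≠ 0), 1 / (m : ℝ) ^ 2 :=
    Finset.sum_congr rfl fun m hm ↦ by rw [invMaxSq_eq (hmem m (Finset.mem_filter.1 hm).1)]
  have hso : ∑ m ∈ (Finset.Ioo (1 : ℤ) (N + 1)).filter (fun m ↦ Odd m ∧ 3 ≤ |m|),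
      1 / max (m : ℝ) 1 ^ 2 =
      ∑ m ∈ (Finset.Ioo (1 : ℤ) (N + 1)).filter (fun m ↦ Odd m ∧ 3 ≤ |m|), 1 / (m : ℝ) ^ 2 :=
    Finset.sum_congr rfl fun m hm ↦ by rw [invMaxSq_eq (hmem m (Finset.mem_filter.1 hm).1)]
  rw [hint, hse, hso]
  beta_reduce
  rw [hg1]
  ring

/-! ## §3. Corollary 4 (ii) from the statement of Theorem 3 -/

/-- `∑_{k<M} 1/(U+k)² ≤ 2/U` for `U ≥ 1` (telescoping; copy of the private helper of the tree's
proof of Corollary 4 (i)). [folklore] -/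
private theorem sum_one_div_sq_le {U : ℝ} (hU : 1 ≤ U) (M : ℕ) :
    ∑ k ∈ Finset.range M, 1 / (U + k) ^ 2 ≤ 2 / U := by
  have key : ∀ M : ℕ, ∑ k ∈ Finset.range M, 1 / (U + k) ^ 2 ≤ 2 / U - 2 / (U + M) := by
    intro M
    induction M with
    | zero => simp
    | succ M ih =>
      rw [Finset.sum_range_succ]
      have hUM : 1 ≤ U + M := by
        have : (0 : ℝ) ≤ M := Nat.cast_nonneg M
        linarith
      have hstep : 1 / (U + M) ^ 2 ≤ 2 / (U + M) - 2 / (U + (M + 1 : ℕ)) := by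
        push_cast
        rw [div_sub_div _ _ (by positivity) (by positivity), div_le_div_iff₀ (by positivity)
          (by positivity)]
        nlinarith
      linarith
  have h := key M
  have : 0 ≤ 2 / (U + M) := by positivity
  linarith

end AH.Cor4OfThm3

open AH.Cor4OfThm3 in
/-- **BGSTB 2025, Corollary 4 (ii) from the STATEMENT of Theorem 3** (and the `T`-free limit
`S = lim_N ∫_1^{N+½} s(α)/α² dα` of the triangle-wave part, a hypothesis here; `S = 1 + log(2/π)` in
the source). Under RH, AH-Pairs and "`p_0` exists" (`AH.HasLimitingDensity 0 δ p₀`):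
`∫_1^∞ F(α,T)/α² dα → S + 2(p_0 − 1)·π²/8 + π²/24` as `T → ∞`. Printed proof (§7): tail
`∫_U^∞ F/α² ≪ 1/U` by Goldston's window bound (here `exists_integral_formFactor_window_le`, `F ≥ 0`,
exactly as in the tree's proof of Corollary 4 (i)); Theorem 3 on `[1, U]`, `U ∉ ℤ` (here `U = N + ½`,
test function `1/max(α,1)²`, `calFIntegral_invMaxSq`); the two `ζ(2)`-series
(`AH.Cor4.tendsto_sum_Ioo_even`, `AH.Cor4.tendsto_sum_Ioo_odd`); and "letting `U = U(T) → ∞`", here an `η/8`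
argument with `U` chosen before `T` and `P_0(T)` bounded through `P_0(T) → p_0`.
[cite: BaluyotGoldstonSuriajayaTurnageButterbaugh2025, Corollary 4 (b) and §7] -/
theorem corollary4_ii_of_theorem3_of_triangleLimit {S : ℝ}
    (hS : Tendsto (fun N : ℕ ↦ ∫ α in (1 : ℝ)..((N : ℝ) + 1 / 2), triangleWave α / α ^ 2)
      atTop (𝓝 S))
    (h3 : bgstb2025_theorem3) :
    RiemannHypothesis → AHPairs → ∀ δ : ℝ, 0 < δ → δ ≤ 1 / 2 → ∀ p₀ : ℝ,
      AH.HasLimitingDensity 0 δ p₀ →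
        Tendsto (fun T : ℝ ↦ ∫ α in Ioi (1 : ℝ), montgomeryFormFactor α T / α ^ 2) atTop
          (𝓝 (S + 2 * (p₀ - 1) * (π ^ 2 / 8) + π ^ 2 / 24)) := by
  intro hRH hAH δ hδ hδ' p₀ hp₀
  obtain ⟨C, hC⟩ := exists_integral_formFactor_window_le hRH
  set C' : ℝ := max C 0 with hC'
  have hC'0 : 0 ≤ C' := le_max_right _ _
  have hπ : 3 < π := Real.pi_gt_three
  have hπ4 : π < 4 := Real.pi_lt_four
  -- the test function
  set g : ℝ → ℝ := fun α ↦ 1 / max α 1 ^ 2 with hg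
  have hglip : ∀ m : ℤ, IsLipschitzAt g m := fun m ↦
    ⟨2, 1, one_pos, fun x _ ↦ abs_invMaxSq_sub_le x m⟩
  have hgr : IsRightLipschitzAt g 1 := ⟨2, 1, one_pos, fun x _ _ ↦ abs_invMaxSq_sub_le x 1⟩
  have hgl : IsLeftLipschitzAt g (-1) := ⟨2, 1, one_pos, fun x _ _ ↦ abs_invMaxSq_sub_le x (-1)⟩
  have hgc : Continuous g := continuous_invMaxSq
  refine Metric.tendsto_nhds.mpr fun η hη ↦ ?_
  -- Step 1: the `T`-free choices — `N` (hence `U = N + ½`)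
  set B : ℝ := |p₀| + 2 with hB
  have hB1 : 1 ≤ B := by have := abs_nonneg p₀; linarith
  have hSev : ∀ᶠ N : ℕ in atTop,
      |(∫ α in (1 : ℝ)..((N : ℝ) + 1 / 2), triangleWave α / α ^ 2) - S| ≤ η / 8 := by
    have := (Metric.tendsto_nhds.mp hS) (η / 8) (by positivity)
    filter_upwards [this] with N hN
    rw [Real.dist_eq] at hN
    exact hN.le
  have hEev : ∀ᶠ N : ℕ in atTop,
      |(∑ m ∈ (Finset.Ioo (1 : ℤ) (N + 1)).filter (fun m ↦ Even m ∧ m ≠ 0), 1 / (m : ℝ) ^ 2) -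
        π ^ 2 / 24| ≤ η / 8 := by
    have := (Metric.tendsto_nhds.mp AH.Cor4.tendsto_sum_Ioo_even) (η / 8) (by positivity)
    filter_upwards [this] with N hN
    rw [Real.dist_eq] at hN
    exact hN.le
  have hOev : ∀ᶠ N : ℕ in atTop,
      |(∑ m ∈ (Finset.Ioo (1 : ℤ) (N + 1)).filter (fun m ↦ Odd m ∧ 3 ≤ |m|), 1 / (m : ℝ) ^ 2) -
        (π ^ 2 / 8 - 1)| ≤ η / (16 * B) := by
    have := (Metric.tendsto_nhds.mp AH.Cor4.tendsto_sum_Ioo_odd) (η / (16 * B)) (by positivity)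
    filter_upwards [this] with N hN
    rw [Real.dist_eq] at hN
    exact hN.le
  have hNev : ∀ᶠ N : ℕ in atTop, (2 * C' + 1) * (8 / η) ≤ (N : ℝ) :=
    tendsto_natCast_atTop_atTop.eventually_ge_atTop _
  obtain ⟨N, hSN, hEN, hON, hNN, hN1⟩ :=
    (hSev.and (hEev.and (hOev.and (hNev.and (eventually_ge_atTop 1))))).exists
  set U : ℝ := (N : ℝ) + 1 / 2 with hU
  have hN0 : (1 : ℝ) ≤ N := by exact_mod_cast hN1
  have hU1 : 1 ≤ U := by linarith
  have hU0 : 0 < U := by linarith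
  have hUη : (2 * C' + 1) / U ≤ η / 8 := by
    rw [div_le_iff₀ hU0]
    have h1 : (2 * C' + 1) * (8 / η) ≤ U := hNN.trans (by linarith)
    calc 2 * C' + 1 = (2 * C' + 1) * (8 / η) * (η / 8) := by field_simp
      _ ≤ U * (η / 8) := by gcongr
      _ = η / 8 * U := mul_comm _ _
  -- Step 2: Theorem 3 on `[1, U]` and the density limit, at one common level `M`
  have hends : ∀ m : ℤ, m ≠ -1 → m ≠ 0 → m ≠ 1 → ((1 : ℝ) ≠ m ∧ U ≠ m) := by
    intro m hm1 hm0 hm1'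
    refine ⟨fun h ↦ hm1' (by exact_mod_cast h.symm), fun h ↦ ?_⟩
    -- `N + 1/2` is not an integer
    have h2 : (2 * N + 1 : ℤ) = 2 * m := by
      have h' : (2 : ℝ) * U = 2 * m := by rw [h]
      rw [hU] at h'
      have h'' : ((2 * N + 1 : ℤ) : ℝ) = 2 * (m : ℝ) := by push_cast; linarith
      exact_mod_cast h''
    omega
  have hbdd : ∃ B' : ℝ, ∀ x ∈ Icc (1 : ℝ) U, |g x| ≤ B' := ⟨1, fun x _ ↦ invMaxSq_le_one x⟩
  have hcont : ∀ᵐ x ∂(volume.restrict (Icc (1 : ℝ) U)), ContinuousWithinAt g (Icc 1 U) x :=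
    Eventually.of_forall fun x ↦ hgc.continuousWithinAt
  have h3U := h3 hRH hAH 1 U g hU1 hends hbdd hcont (fun m _ _ ↦ hglip m) hgr hgl δ hδ hδ'
  obtain ⟨M, h3M, hpM⟩ := (h3U.and hp₀).exists
  -- Step 3: the events in `T`
  have h3T : ∀ᶠ T : ℝ in atTop,
      |(∫ α in (1 : ℝ)..U, montgomeryFormFactor α T * g α) -
        AH.calFIntegral (AH.binDensity 0 T M δ) 1 U g| ≤ η / 8 := by
    have := (Metric.tendsto_nhds.mp h3M) (η / 8) (by positivity)
    filter_upwards [this] with T hT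
    rw [Real.dist_eq, sub_zero] at hT
    exact hT.le
  have hpT : ∀ᶠ T : ℝ in atTop, |AH.binDensity 0 T M δ - p₀| ≤ η / 32 := by
    have := (Metric.tendsto_nhds.mp hpM) (η / 32) (by positivity)
    filter_upwards [this] with T hT
    rw [Real.dist_eq] at hT
    exact hT.le
  have hpT' : ∀ᶠ T : ℝ in atTop, |AH.binDensity 0 T M δ - p₀| ≤ 1 := by
    have := (Metric.tendsto_nhds.mp hpM) 1 one_pos
    filter_upwards [this] with T hT
    rw [Real.dist_eq] at hT
    exact hT.le
  filter_upwards [hC, h3T, hpT, hpT', eventually_gt_atTop (1 : ℝ)] with T hCT h3T' hpT₁ hpT₂ hT1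
  -- abbreviations and basic facts at this `T`
  set F : ℝ → ℝ := fun α ↦ montgomeryFormFactor α T with hF
  set P : ℝ := AH.binDensity 0 T M δ with hP
  have hF0 : ∀ a, 0 ≤ F a := fun a ↦ Montgomery.montgomeryFormFactor_nonneg a hT1
  have hFc : Continuous F := RudnickSarnak.continuous_montgomeryFormFactor T
  set Bd : ℝ := |2 * π / (T * Real.log T)| * ((zeroIndexSet T ×ˢ zeroIndexSet T).card : ℝ)
    with hBd
  have hFB : ∀ a, |F a| ≤ Bd := fun a ↦ abs_montgomeryFormFactor_le a T
  have hcontOn : ContinuousOn (fun α ↦ F α / α ^ 2) (Ioi 0) :=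
    hFc.continuousOn.div (continuousOn_pow 2) fun x hx ↦ pow_ne_zero _ (ne_of_gt hx)
  -- integrability of `F/α²` on `(1, ∞)`
  have hint1 : IntegrableOn (fun α ↦ F α / α ^ 2) (Ioi (1 : ℝ)) := by
    have hrpow : IntegrableOn (fun α : ℝ ↦ Bd * α ^ (-2 : ℝ)) (Ioi (1 : ℝ)) :=
      (integrableOn_Ioi_rpow_of_lt (by norm_num : (-2 : ℝ) < -1) one_pos).const_mul Bd
    refine hrpow.mono' ((hcontOn.mono (Ioi_subset_Ioi zero_le_one)).aestronglyMeasurable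
      measurableSet_Ioi) ?_
    filter_upwards [self_mem_ae_restrict measurableSet_Ioi] with α hα
    have hα0 : 0 < α := lt_trans one_pos hα
    rw [Real.norm_eq_abs, abs_div, abs_of_pos (pow_pos hα0 2), Real.rpow_neg hα0.le,
      Real.rpow_two, div_eq_mul_inv]
    exact mul_le_mul_of_nonneg_right (hFB α) (inv_nonneg.mpr (sq_nonneg α))
  -- split `(1, ∞) = (1, U] ∪ (U, ∞)`
  have hsplit : ∫ α in Ioi (1 : ℝ), F α / α ^ 2 =
      (∫ α in Ioc (1 : ℝ) U, F α / α ^ 2) + ∫ α in Ioi U, F α / α ^ 2 := by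
    rw [← setIntegral_union (s := Ioc (1 : ℝ) U) (t := Ioi U) Ioc_disjoint_Ioi_same
      measurableSet_Ioi (hint1.mono_set Ioc_subset_Ioi_self)
      (hint1.mono_set (Ioi_subset_Ioi hU1)), Ioc_union_Ioi_eq_Ioi hU1]
  -- (a) the main part equals the interval integral `∫_1^U F g`
  have hmain_eq : ∫ α in Ioc (1 : ℝ) U, F α / α ^ 2 = ∫ α in (1 : ℝ)..U, F α * g α := by
    rw [intervalIntegral.integral_of_le hU1]
    refine setIntegral_congr_fun measurableSet_Ioc fun α hα ↦ ?_
    simp only [hg]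
    rw [invMaxSq_eq hα.1.le]
    ring
  -- (b) the tail: `0 ≤ ∫_{(U,∞)} F/α² ≤ 2C'/U`
  have htailI : IntegrableOn (fun α ↦ F α / α ^ 2) (Ioi U) := hint1.mono_set (Ioi_subset_Ioi hU1)
  have htail0 : 0 ≤ ∫ α in Ioi U, F α / α ^ 2 :=
    setIntegral_nonneg measurableSet_Ioi fun α _ ↦ div_nonneg (hF0 α) (sq_nonneg α)
  have hwindow : ∀ n : ℕ, ∫ a in (U + n)..(U + n + 1), F a / a ^ 2 ≤ C' / (U + n) ^ 2 := by
    intro n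
    have hUn : 0 < U + n := by positivity
    have hcI : ∀ f : ℝ → ℝ, ContinuousOn f (Icc (U + n) (U + n + 1)) →
        IntervalIntegrable f volume (U + n) (U + n + 1) := fun f hf ↦ by
      refine (hf.mono ?_).intervalIntegrable
      rw [uIcc_of_le (by linarith)]
    have hc1 : ContinuousOn (fun a ↦ F a / a ^ 2) (Icc (U + n) (U + n + 1)) :=
      hcontOn.mono fun a ha ↦ lt_of_lt_of_le hUn ha.1
    have hc2 : ContinuousOn (fun a ↦ F a / (U + n) ^ 2) (Icc (U + n) (U + n + 1)) :=
      (hFc.div_const _).continuousOn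
    have h1 : ∫ a in (U + n)..(U + n + 1), F a / a ^ 2 ≤
        ∫ a in (U + n)..(U + n + 1), F a / (U + n) ^ 2 := by
      refine intervalIntegral.integral_mono_on (by linarith) (hcI _ hc1) (hcI _ hc2)
        fun a ha ↦ ?_
      exact div_le_div_of_nonneg_left (hF0 a) (pow_pos hUn 2) (pow_le_pow_left₀ hUn.le ha.1 2)
    have h2 : ∫ a in (U + n)..(U + n + 1), F a ≤ C' := by
      have h := hCT (U + n + 1 / 2)
      rw [show U + n + 1 / 2 - 1 / 2 = U + n by ring,
        show U + n + 1 / 2 + 1 / 2 = U + n + 1 by ring] at h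
      exact h.trans (le_max_left _ _)
    calc ∫ a in (U + n)..(U + n + 1), F a / a ^ 2
        ≤ ∫ a in (U + n)..(U + n + 1), F a / (U + n) ^ 2 := h1
      _ = (∫ a in (U + n)..(U + n + 1), F a) / (U + n) ^ 2 :=
          intervalIntegral.integral_div _ _
      _ ≤ C' / (U + n) ^ 2 := div_le_div_of_nonneg_right h2 (pow_pos hUn 2).le
  have hpartial : ∀ K : ℕ, ∫ a in U..(U + K), F a / a ^ 2 ≤ 2 * C' / U := by
    intro K
    have hint : ∀ k < K, IntervalIntegrable (fun a ↦ F a / a ^ 2) volume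
        (U + (k : ℕ)) (U + ((k + 1 : ℕ) : ℝ)) := by
      intro k _
      have hUk : 0 < U + k := by positivity
      have hc : ContinuousOn (fun a ↦ F a / a ^ 2)
          (uIcc (U + (k : ℕ)) (U + ((k + 1 : ℕ) : ℝ))) := by
        refine hcontOn.mono fun a ha ↦ ?_
        rw [uIcc_of_le (by push_cast; linarith)] at ha
        exact lt_of_lt_of_le hUk ha.1
      exact hc.intervalIntegrable
    have hsum := intervalIntegral.sum_integral_adjacent_intervals hint
    simp only [Nat.cast_zero, add_zero] at hsum
    rw [← hsum]
    calc ∑ k ∈ Finset.range K, ∫ a in (U + (k : ℕ))..(U + ((k + 1 : ℕ) : ℝ)), F a / a ^ 2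
        ≤ ∑ k ∈ Finset.range K, C' / (U + k) ^ 2 := by
          refine Finset.sum_le_sum fun k _ ↦ ?_
          have h := hwindow k
          rwa [show (U + (k : ℕ) : ℝ) + 1 = U + ((k + 1 : ℕ) : ℝ) by push_cast; ring] at h
      _ = C' * ∑ k ∈ Finset.range K, 1 / (U + k) ^ 2 := by
          rw [Finset.mul_sum]
          refine Finset.sum_congr rfl fun k _ ↦ ?_
          ring
      _ ≤ C' * (2 / U) := by gcongr; exact sum_one_div_sq_le hU1 K
      _ = 2 * C' / U := by ring
  have hlim : Tendsto (fun K : ℕ ↦ ∫ a in U..(U + K), F a / a ^ 2) atTop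
      (𝓝 (∫ a in Ioi U, F a / a ^ 2)) :=
    intervalIntegral_tendsto_integral_Ioi U htailI
      (tendsto_atTop_add_const_left _ _ tendsto_natCast_atTop_atTop)
  have htail : ∫ α in Ioi U, F α / α ^ 2 ≤ 2 * C' / U := le_of_tendsto' hlim hpartial
  have htail' : ∫ α in Ioi U, F α / α ^ 2 ≤ η / 8 := by
    refine htail.trans (le_trans ?_ hUη)
    gcongr
    linarith
  -- (c) the closed form of the limiting functional at this `U`, and its distance to the target
  have hcalF := calFIntegral_invMaxSq P hN1
  have hPB : |P - 1| ≤ B := by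
    have h1 : |P - 1| ≤ |P - p₀| + |p₀ - 1| := abs_sub_le P p₀ 1
    have h2 : |p₀ - 1| ≤ |p₀| + 1 := by
      calc |p₀ - 1| ≤ |p₀| + |(1 : ℝ)| := abs_sub _ _
        _ = |p₀| + 1 := by rw [abs_one]
    rw [hB]
    linarith
  -- distance of `calF(P, U)` to `S + 2(P−1)π²/8 + π²/24`
  have hd1 : |AH.calFIntegral P 1 U g - (S + 2 * (P - 1) * (π ^ 2 / 8) + π ^ 2 / 24)| ≤
      η / 8 + η / 8 + η / 8 := by
    rw [hU, hcalF]
    have e : (∫ α in (1 : ℝ)..((N : ℝ) + 1 / 2), triangleWave α / α ^ 2) + 2 * (P - 1) +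
        (∑ m ∈ (Finset.Ioo (1 : ℤ) (N + 1)).filter (fun m ↦ Even m ∧ m ≠ 0), 1 / (m : ℝ) ^ 2) +
        2 * (P - 1) * (∑ m ∈ (Finset.Ioo (1 : ℤ) (N + 1)).filter (fun m ↦ Odd m ∧ 3 ≤ |m|),
          1 / (m : ℝ) ^ 2) - (S + 2 * (P - 1) * (π ^ 2 / 8) + π ^ 2 / 24) =
        ((∫ α in (1 : ℝ)..((N : ℝ) + 1 / 2), triangleWave α / α ^ 2) - S) +
        ((∑ m ∈ (Finset.Ioo (1 : ℤ) (N + 1)).filter (fun m ↦ Even m ∧ m ≠ 0), 1 / (m : ℝ) ^ 2) -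
          π ^ 2 / 24) +
        2 * (P - 1) * ((∑ m ∈ (Finset.Ioo (1 : ℤ) (N + 1)).filter (fun m ↦ Odd m ∧ 3 ≤ |m|),
          1 / (m : ℝ) ^ 2) - (π ^ 2 / 8 - 1)) := by ring
    rw [e]
    refine (abs_add_three _ _ _).trans (add_le_add (add_le_add hSN hEN) ?_)
    rw [abs_mul, abs_mul, abs_two]
    have hB0 : 0 < B := by linarith
    calc 2 * |P - 1| * |(∑ m ∈ (Finset.Ioo (1 : ℤ) (N + 1)).filter (fun m ↦ Odd m ∧ 3 ≤ |m|),
          1 / (m : ℝ) ^ 2) - (π ^ 2 / 8 - 1)| ≤ 2 * B * (η / (16 * B)) := by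
          gcongr
      _ = η / 8 := by field_simp; ring
  -- distance of the two targets: `|C(P) − C(p₀)| = 2|P − p₀| π²/8 ≤ η/8`
  have hd2 : |(S + 2 * (P - 1) * (π ^ 2 / 8) + π ^ 2 / 24) -
      (S + 2 * (p₀ - 1) * (π ^ 2 / 8) + π ^ 2 / 24)| ≤ η / 8 := by
    have e : (S + 2 * (P - 1) * (π ^ 2 / 8) + π ^ 2 / 24) -
        (S + 2 * (p₀ - 1) * (π ^ 2 / 8) + π ^ 2 / 24) = (π ^ 2 / 4) * (P - p₀) := by ring
    rw [e, abs_mul, abs_of_pos (by positivity)]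
    have hπ2 : π ^ 2 / 4 ≤ 4 := by nlinarith
    calc π ^ 2 / 4 * |P - p₀| ≤ 4 * (η / 32) :=
          mul_le_mul hπ2 hpT₁ (abs_nonneg _) (by norm_num)
      _ = η / 8 := by ring
  -- (d) assemble
  rw [Real.dist_eq, hsplit, hmain_eq]
  have key : |(∫ α in (1 : ℝ)..U, F α * g α) - (S + 2 * (p₀ - 1) * (π ^ 2 / 8) + π ^ 2 / 24)| ≤
      η / 8 + (η / 8 + η / 8 + η / 8) + η / 8 := by
    have e : (∫ α in (1 : ℝ)..U, F α * g α) - (S + 2 * (p₀ - 1) * (π ^ 2 / 8) + π ^ 2 / 24) =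
        ((∫ α in (1 : ℝ)..U, F α * g α) - AH.calFIntegral P 1 U g) +
        (AH.calFIntegral P 1 U g - (S + 2 * (P - 1) * (π ^ 2 / 8) + π ^ 2 / 24)) +
        ((S + 2 * (P - 1) * (π ^ 2 / 8) + π ^ 2 / 24) -
          (S + 2 * (p₀ - 1) * (π ^ 2 / 8) + π ^ 2 / 24)) := by ring
    rw [e]
    exact (abs_add_three _ _ _).trans (add_le_add (add_le_add h3T' hd1) hd2)
  have htail_abs : |∫ α in Ioi U, F α / α ^ 2| ≤ η / 8 := by
    rw [abs_of_nonneg htail0]; exact htail'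
  calc |(∫ α in (1 : ℝ)..U, F α * g α) + (∫ α in Ioi U, F α / α ^ 2) -
        (S + 2 * (p₀ - 1) * (π ^ 2 / 8) + π ^ 2 / 24)|
      = |((∫ α in (1 : ℝ)..U, F α * g α) - (S + 2 * (p₀ - 1) * (π ^ 2 / 8) + π ^ 2 / 24)) +
          ∫ α in Ioi U, F α / α ^ 2| := by ring_nf
    _ ≤ |(∫ α in (1 : ℝ)..U, F α * g α) - (S + 2 * (p₀ - 1) * (π ^ 2 / 8) + π ^ 2 / 24)| +
          |∫ α in Ioi U, F α / α ^ 2| := abs_add_le _ _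
    _ ≤ η / 8 + (η / 8 + η / 8 + η / 8) + η / 8 + η / 8 := add_le_add key htail_abs
    _ < η := by linarith

/-- The triangle-wave constant along the half-integers: `∫_1^{N+½} s(α)/α² dα → 1 + log(2/π)`
(the cell's `AH.Cor4.tendsto_integral_triangleWave_div_sq`, along `U → ∞` real, composed with
`N + ½ → ∞`). [cite: BaluyotGoldstonSuriajayaTurnageButterbaugh2025, §7 (proof of Corollary 4)] -/
theorem AH.Cor4OfThm3.tendsto_integral_triangleWave_div_sq_halfInt :
    Tendsto (fun N : ℕ ↦ ∫ α in (1 : ℝ)..((N : ℝ) + 1 / 2), triangleWave α / α ^ 2) atTop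
      (𝓝 (1 + Real.log (2 / π))) :=
  AH.Cor4.tendsto_integral_triangleWave_div_sq.comp
    (tendsto_atTop_add_const_right atTop (1 / 2) tendsto_natCast_atTop_atTop)

open AH.Cor4OfThm3 in
/-- **BGSTB 2025, Corollary 4 (ii) from the STATEMENT of Theorem 3**: "Suppose that the limiting
density `p_0` exists, then assuming the Riemann Hypothesis and AH-Pairs we obtain
`𝒞 = 1 + (3/2(p_0 − 1) + 1/4) π²/6 + log(2/π)`" — conjunct (ii) of the typed `bgstb2025_corollary4`
verbatim, derived from `bgstb2025_theorem3` (hypothesis `h3`): `corollary4_ii_of_theorem3_of_triangleLimit`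
with the triangle-wave constant `1 + log(2/π)` (`tendsto_integral_triangleWave_div_sq_halfInt`) and
`(1 + log(2/π)) + 2(p_0−1)π²/8 + π²/24 = 1 + (3/2(p_0−1) + 1/4)π²/6 + log(2/π)` (`ring`; the cell's
`AH.Cor4.corollary4_constant`). LABEL: NOT RH-BEARING — RH and AH-Pairs stay hypotheses inside the
statement. [cite: BaluyotGoldstonSuriajayaTurnageButterbaugh2025, Corollary 4 (b) and §7] -/
theorem bgstb2025_corollary4_ii_of_theorem3 (h3 : bgstb2025_theorem3) :
    RiemannHypothesis → AHPairs → ∀ δ : ℝ, 0 < δ → δ ≤ 1 / 2 → ∀ p₀ : ℝ,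
      AH.HasLimitingDensity 0 δ p₀ →
        Tendsto (fun T : ℝ ↦ ∫ α in Ioi (1 : ℝ), montgomeryFormFactor α T / α ^ 2) atTop
          (𝓝 (1 + (3 / 2 * (p₀ - 1) + 1 / 4) * (π ^ 2 / 6) + Real.log (2 / π))) := by
  intro hRH hAH δ hδ hδ' p₀ hp₀
  have h := corollary4_ii_of_theorem3_of_triangleLimit tendsto_integral_triangleWave_div_sq_halfInt
    h3 hRH hAH δ hδ hδ' p₀ hp₀
  have e : 1 + Real.log (2 / π) + 2 * (p₀ - 1) * (π ^ 2 / 8) + π ^ 2 / 24 =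
      1 + (3 / 2 * (p₀ - 1) + 1 / 4) * (π ^ 2 / 6) + Real.log (2 / π) := by ring
  rwa [e] at h

/-- **BGSTB 2025, Corollary 4 — all four conjuncts — from the STATEMENT of Theorem 3**
(`bgstb2025_theorem3 → bgstb2025_corollary4`): (i) is the tree's `bgstb2025_corollary4_i` (RH +
Montgomery's uniform prediction ⇒ `𝒞 = 1`); (ii) is `bgstb2025_corollary4_ii_of_theorem3`; (iii), (iv)
are (ii) at `p_0 = 1`, `p_0 = 3/2 − 2/π²` (`bgstb2025_corollary4_special_of_general`). So the named
fact `bgstb2025_corollary4` is PROVED MODULO `bgstb2025_theorem3` alone, and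
`bgstb2025_corollary4_holds := bgstb2025_corollary4_of_theorem3 bgstb2025_theorem3_holds` the moment
Theorem 3 is discharged. LABEL: NOT RH-BEARING — the typed Corollary 4 keeps RH, AH-Pairs (and
Montgomery's prediction in (i)) as hypotheses INSIDE its statement; CLAIM of an unrefereed source
typed by the cell, deduction ours. [cite: BaluyotGoldstonSuriajayaTurnageButterbaugh2025, Corollary 4 and §7] -/
theorem bgstb2025_corollary4_of_theorem3 (h3 : bgstb2025_theorem3) : bgstb2025_corollary4 := by
  have hii := bgstb2025_corollary4_ii_of_theorem3 h3
  obtain ⟨hiii, hiv⟩ := bgstb2025_corollary4_special_of_general hii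
  exact ⟨bgstb2025_corollary4_i, hii, hiii, hiv⟩

/-- **BGSTB 2025, Corollary 4 DISCHARGED**: the named fact `bgstb2025_corollary4` holds — all four
conjuncts, each a CONDITIONAL whose hypotheses (RH; Montgomery's uniform prediction in (i); AH-Pairs
and the existence of `p_0` in (ii)–(iv)) stay INSIDE the statement, as printed. Proof:
`bgstb2025_corollary4_of_theorem3 bgstb2025_theorem3_holds` (Theorem 3 is discharged in the tree by
`AlternativeHypothesisTheorem3Holds.lean`). LABEL: NOT RH-BEARING; CLAIM of an unrefereed source,
typed by the cell, proof ours. [cite: BaluyotGoldstonSuriajayaTurnageButterbaugh2025, Corollary 4] -/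
theorem bgstb2025_corollary4_holds : bgstb2025_corollary4 :=
  bgstb2025_corollary4_of_theorem3 bgstb2025_theorem3_holds

end Literature.NumberTheory.LFunctions

end
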